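import Mathlib
import HarnessLib
import Literature.MathematicalPhysics.QuantumLattice.HubbardSectorFieldSubstitution
import Summits.HubbardSuperconductivity.HubbardSuperconductivity.Theorems.KLProgrammeKLRegimeEngineScaleZeroE4Geometry
import Summits.HubbardSuperconductivity.HubbardSuperconductivity.Theorems.KLProgrammeKLRegimeSplitBundleV16
import Summits.HubbardSuperconductivity.HubbardSuperconductivity.Theorems.KLProgrammeKLRegimeEngineV8DefsG5
import Summits.HubbardSuperconductivity.HubbardSuperconductivity.Theorems.KLProgrammeKLRegimeEngineV8DefsU4
import Summits.HubbardSuperconductivity.HubbardSuperconductivity.Theorems.KLProgrammeKLRegimeKernelNormsLevelsDefs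
import Summits.HubbardSuperconductivity.HubbardSuperconductivity.Theorems.KLProgrammeKLRegimeSplitThermalLayer

/-!
# K3 engine child `KLRegimeEngineV16` (stmt-HubbardSuperconductivity-20236), stub (c) `stub_engine_step_values`, residue hE4ₙ:
# THE (E4)ₙ DOOR AT THE INDUCTIVE SCALES — first space-time moments of the scale-`n` sectorised quartic kernel from ONE weighted pinned sum

Cell gate-hubbard-kl, seat hubbard-kl-k3c3-p2 (g6; plan g15 START-HERE, HOME STATUS 2026-08-27 l.2319; r2d-p1 g4's provability point l.2375 and the
pen's pre-decision l.2378).  Clause (E4)ₙ of stub (c) asks, for every label 4-tuple `Ω`, every pair of legs `i, k` and `1 ≤ n`,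
`ε_x³ · Σ_x spaceTimeDist(x_i, x_k) · ‖klAnisoLegKernel … klE0 n 4 Ω (0, x)‖ ≤ (G.cE4 + Q.cE4|U|)·Klam·|U|·4ⁿ` (`EngineFirstMoments … n`,
…SplitPredicates l.254) — it is load-bearing (child 1's (B4) ladder-localisation error reads it) and it is k3c2-p2's value-lane residue `hE4`
of `klvr16_stepValues_of_reduced`.  This file is the n ≥ 1 twin of k3c2-p1's scale-`0` chain (`firstMoment_zero_le_of_wgridStep` →
`engineFirstMoments_zero_of_e4ScaleZeroAt`) in MOMENT-BOOKKEEPING currency only: it fixes the WEIGHT, the ONE inequality the analytic lanes owe,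
and the constant fit; the weighted determinant bound itself is not here.

* §1 the SCALE-`n` TREE WEIGHT `klScaleWt L M β n S = 1 + Λ_n · diam_d(S)` on the position sets of the `4M`-grid bookkeeping of
  `…ScaleZeroE4Defs` (`d = gridLabelDist L (4M) β`, `Λ_n = klScale klE0 n`): a tree weight (`isTreeWeight_klScaleWt`) whose pair value dominates
  `Λ_n · spaceTimeDist` of lattice legs (`klScale_mul_spaceTimeDist_le_klScaleWt_image`) — measuring distances in units of the scale's range
  `Λ_n⁻¹ = 32·4ⁿ` is what makes the weighted profile of the scale-`n` kernels an `n`-free multiple of the unweighted one;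
* §2 the scale-`n` sectorised kernel IS a kernel of the analysed action `map (toLin' E_n) 𝒱⁽ⁿ⁾` at every scale (`klAnisoLegKernel_eq_kernel_map`,
  generic-`n` form of k3c2-p1's `klAnisoLegKernel_zero_eq_kernel_map`), and **`klWtPinnedSum … n m q w`** := `ε_x^{m−1} · Σ_{X : X q = w}
  klScaleWt_n(positions of X) · ‖kernel (map (toLin' E_n) 𝒱⁽ⁿ⁾) m X‖` — the `wt`-WEIGHTED PINNED SUM of the analysed scale-`n` action in EXACTLY
  the input/output format of the weighted determinant-bounded steps (`GrassmannWeightedEffectiveActionBiGradedMap` `hN` / conclusion: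
  leg `q` pinned at the field index `w = (x, ℓ)`, every other leg summed over positions AND labels, tree weight of the position image);
* §3 **`KernelNormsWt N … n`** := `∀ m q w, klWtPinnedSum … n m q w ≤ N m` — the (E1-W) shape of r2d-p1 l.2375 / pen l.2378 with an ABSTRACT
  degree profile `N : ℕ → ℝ` (the budget term is the E1/E4 lanes'; a registrant threads `KernelNormsWt (term …) … j` verbatim like (E1-F));
* §4 THE DOOR: `klScale_mul_firstMoment_le_klWtPinnedSum` (`Λ_n · ε_x³ · Σ_x dist(x_i,x_k)‖W̄_Ω(0,x)‖ ≤ klWtPinnedSum … n 4 0 (0, Ω 0)`, pure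
  bookkeeping, every `n`), **`engineFirstMoments_of_wtPinnedSum`** (ONE inequality per pinned first label:
  `klWtPinnedSum … n 4 0 (0, ℓ₀) ≤ klE0 · (G.cE4 + Q.cE4|U|)·P.Klam·|U|` ⇒ `EngineFirstMoments … n`; note `Λ_n · 4ⁿ = klE0`, so the budget of the
  weighted sum is `n`-FREE), `engineFirstMoments_of_kernelNormsWt`;
* §5 the constant packaging at the gen-6 engine package, n ≥ 1 twin of `…EngineE4ConstDefs`: **`E4ScaleAt E`** («`E` is an admissible (E4)ₙ
  constant under the LITERAL binders of stub (c) of skeleton v3-α 9747d23d14535406»), `E4ScaleAt.mono`, the closed term `klE4Tn`, `e4ScaleAt_klE4Tn`,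
  and the consumer form **`engineFirstMoments_of_e4ScaleAt`** (`E ≤ G.cE4` ⇒ the clause at `G`, in particular at `klEngGeo5` when
  `E ≤ klEngGeo5.cE4 = max 2^10 klE4T`; otherwise it rides the (R20)(c) package swap as `cE4 := max … klE4Tn`).

RESIDUAL TABLE (what is NOT here, by lane): the bound `klWtPinnedSum … n 4 0 (0, ℓ₀) ≤ klE0·E·Klam·|U|` itself — either (i) ONE-STEP: the weighted
sectorised determinant-bounded step from `map E_{n−1} 𝒱⁽ⁿ⁻¹⁾` with the slice covariance, whose INPUT is `KernelNormsWt N_{n−1} … (n−1)` in ALL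
degrees (then (E1-W) is threaded through stubs (b)/(c) exactly like (E1-F); scale `0` from k3c2-p1's weighted chain) [E1 lead k3c2-p3 / r2d-p2 (b)-door /
k3c2-p1 successor], or (ii) MULTI-SCALE: a tree expansion from scale `0` with the `klScaleWt_n` decay produced along the tree [k3c1-p1 / p1 lanes];
the slice-covariance weighted row/column sums (`α_w` at scale n: first space-time moment of `klSliceCov n` in units of `Λ_n⁻¹` — O(1)) and the
sector-analysis overlap sizes `cr_w, cc_w` at scale n [k3c2-p3, p4 layer B]; the fit of `E` against `klEngGeo5.cE4` [k3c2-p2 / registrant].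
Definitions + bookkeeping theorems only; no analysis; nothing about superconductivity is asserted.
-/

noncomputable section

namespace Summit.HubbardSuperconductivity.HubbardSuperconductivity.Theorems.EngineV8

set_option linter.dupNamespace false -- summit = problem name (single-conjunct summit), D-0017

open Real Finset Literature.MathematicalPhysics.QuantumLattice Literature.Probability.LatticeModels
open Literature.Probability.LatticeModels.BattleFederbush
open Literature.MathematicalPhysics.QuantumLattice.GrassmannAlgebra
open Summit.HubbardSuperconductivity.HubbardSuperconductivity.Theorems.KLRegimeSplit
open Summit.HubbardSuperconductivity.HubbardSuperconductivity.Theorems.KLProgrammeLegKernels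
open Summit.HubbardSuperconductivity.HubbardSuperconductivity.Theorems.DispersionFlow

/-! ## §1 The scale-`n` tree weight -/

/-- **The scale-`n` tree weight** on the position sets of the `4M`-grid bookkeeping: `klScaleWt L M β n S = 1 + Λ_n · diam_d(S)`,
`d = gridLabelDist L (4M) β`, `Λ_n = klScale klE0 n` (distances in units of the scale's range `Λ_n⁻¹`). -/
def klScaleWt (L M : ℕ) (β : ℝ) (n : ℕ) (S : Finset (ZMod (2 * (2 * M)) × TorusSite 2 L)) : ℝ :=
  diamWeight (fun s => 1 + klScale klE0 n * s) (gridLabelDist L (2 * (2 * M)) β) S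

/-- Unfolding `klScaleWt`. -/
theorem klScaleWt_apply (L M : ℕ) (β : ℝ) (n : ℕ) (S : Finset (ZMod (2 * (2 * M)) × TorusSite 2 L)) :
    klScaleWt L M β n S = 1 + klScale klE0 n * labelDiam (gridLabelDist L (2 * (2 * M)) β) S := rfl

/-- `Λ_n · 4ⁿ = klE0`. -/
theorem klScale_klE0_mul_four_pow (n : ℕ) : klScale klE0 n * (4 : ℝ) ^ n = klE0 := by
  unfold klScale
  have h : (4 : ℝ) ^ n ≠ 0 := pow_ne_zero n (by norm_num)
  field_simp

/-- **`klScaleWt` is a tree weight** (`β ≥ 0`): `s ↦ 1 + Λ_n s` is `≥ 1`, monotone and submultiplicative on `[0, ∞)`. -/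
theorem isTreeWeight_klScaleWt (L M : ℕ) [NeZero L] [NeZero M] {β : ℝ} (hβ : 0 ≤ β) (n : ℕ) : IsTreeWeight (klScaleWt L M β n) := by
  haveI : NeZero (2 * (2 * M)) := ⟨by have := NeZero.ne M; omega⟩
  have hΛ := (klth_klScale_pos n).le
  show IsTreeWeight (diamWeight (fun s => 1 + klScale klE0 n * s) (gridLabelDist L (2 * (2 * M)) β))
  refine isTreeWeight_diamWeight (isLabelDist_gridLabelDist L (2 * (2 * M)) hβ) (fun s hs => ?_) (fun s t hs hst => ?_)
    (fun s t hs ht => ?_)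
  · have := mul_nonneg hΛ hs; linarith
  · have := mul_le_mul_of_nonneg_left hst hΛ; linarith
  · have h1 := mul_nonneg hΛ hs
    have h2 := mul_nonneg hΛ ht
    nlinarith [mul_nonneg h1 h2]

/-- `1 ≤ klScaleWt`. -/
theorem one_le_klScaleWt (L M : ℕ) (β : ℝ) (n : ℕ) (S : Finset (ZMod (2 * (2 * M)) × TorusSite 2 L)) : 1 ≤ klScaleWt L M β n S := by
  rw [klScaleWt_apply]
  have := mul_nonneg (klth_klScale_pos n).le (labelDiam_nonneg (gridLabelDist L (2 * (2 * M)) β) S)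
  linarith

/-- **Scaled distances inside a lattice tuple are dominated by the weight of its position set**:
`Λ_n · spaceTimeDist(X i, X k) ≤ klScaleWt_n(positions of X) − 1` (`β ≥ 0`). -/
theorem klScale_mul_spaceTimeDist_le_klScaleWt_image_sub_one {L M Ns : ℕ} [NeZero L] [NeZero M] {β : ℝ} (hβ : 0 ≤ β) (n : ℕ)
    {ι : Type*} [Fintype ι] [DecidableEq ι] (X : ι → SpaceTimeIdx L M × SectorLeg Ns) (i k : ι) :
    klScale klE0 n * KLRegimeSplit.spaceTimeDist L M β (X i).1 (X k).1 ≤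
      klScaleWt L M β n ((univ.image X).image (latticeLegPos (2 * (2 * M)))) - 1 := by
  rw [klScaleWt_apply, add_sub_cancel_left]
  refine mul_le_mul_of_nonneg_left ?_ (klth_klScale_pos n).le
  refine (spaceTimeDist_le_gridLabelDist_latticeLegPos hβ (X i) (X k)).trans ?_
  exact le_labelDiam _ (mem_image_of_mem _ (mem_image_of_mem _ (mem_univ i))) (mem_image_of_mem _ (mem_image_of_mem _ (mem_univ k)))

/-! ## §2 The analysed scale-`n` action and its weighted pinned sums -/

section Model

variable {L M : ℕ} [NeZero L]

/-- **The scale-`n` sectorised kernel is a kernel of the analysed action** (every scale, every cutoff unit `e₀`):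
`klAnisoLegKernel … e₀ n m Ω X = kernel (map (toLin' (sectorAnalysisMatrix β (klAnisoFamily … e₀ n))) (klEffectiveAction … e₀ n)) m (j ↦ (X j, Ω j))`. -/
theorem klAnisoLegKernel_eq_kernel_map (β U μ : ℝ) (K : TrigPolyC4v) (e₀ : ℝ) (n m : ℕ)
    (Ω : Fin m → SectorLeg (sectorCount n)) (X : Fin m → SpaceTimeIdx L M) :
    klAnisoLegKernel L M β U μ K e₀ n m Ω X =
      kernel ℂ (ExteriorAlgebra.map (Matrix.toLin' (sectorAnalysisMatrix L M β (klAnisoFamily L M β μ K e₀ n)))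
        (klEffectiveAction L M β U μ K e₀ n)) m (fun j => (X j, Ω j)) := by
  rw [klAnisoLegKernel, kernel_map_sectorAnalysis]

variable (L M)

/-- **The weighted pinned sum of the analysed scale-`n` action** in degree `m`, leg `q` pinned at the field index `w = (x, ℓ)`:
`ε_x^{m−1} · Σ_{X : X q = w} klScaleWt_n(positions of X) · ‖kernel (map (toLin' E_n) 𝒱⁽ⁿ⁾) m X‖` — every other leg summed over positions AND labels
(the format of the weighted determinant-bounded steps' input profile `hN` and of their conclusion). -/
def klWtPinnedSum (β U μ : ℝ) (K : TrigPolyC4v) (n m : ℕ) (q : Fin m) (w : SpaceTimeIdx L M × SectorLeg (sectorCount n)) : ℝ :=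
  imagTimeWeight β M ^ (m - 1) *
    ∑ X ∈ univ.filter (fun X : Fin m → SpaceTimeIdx L M × SectorLeg (sectorCount n) => X q = w),
      klScaleWt L M β n ((univ.image X).image (latticeLegPos (2 * (2 * M)))) *
        ‖kernel ℂ (ExteriorAlgebra.map (Matrix.toLin' (sectorAnalysisMatrix L M β (klAnisoFamily L M β μ K klE0 n)))
            (klEffectiveAction L M β U μ K klE0 n)) m X‖

/-- Unfolding `klWtPinnedSum`. -/
theorem klWtPinnedSum_def (β U μ : ℝ) (K : TrigPolyC4v) (n m : ℕ) (q : Fin m) (w : SpaceTimeIdx L M × SectorLeg (sectorCount n)) :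
    klWtPinnedSum L M β U μ K n m q w = imagTimeWeight β M ^ (m - 1) *
      ∑ X ∈ univ.filter (fun X : Fin m → SpaceTimeIdx L M × SectorLeg (sectorCount n) => X q = w),
        klScaleWt L M β n ((univ.image X).image (latticeLegPos (2 * (2 * M)))) *
          ‖kernel ℂ (ExteriorAlgebra.map (Matrix.toLin' (sectorAnalysisMatrix L M β (klAnisoFamily L M β μ K klE0 n)))
              (klEffectiveAction L M β U μ K klE0 n)) m X‖ := rfl

/-- `0 ≤ klWtPinnedSum` (`β ≥ 0`). -/
theorem klWtPinnedSum_nonneg {β : ℝ} (hβ : 0 ≤ β) (U μ : ℝ) (K : TrigPolyC4v) (n m : ℕ) (q : Fin m)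
    (w : SpaceTimeIdx L M × SectorLeg (sectorCount n)) : 0 ≤ klWtPinnedSum L M β U μ K n m q w := by
  rw [klWtPinnedSum_def]
  refine mul_nonneg (pow_nonneg (imagTimeWeight_nonneg hβ M) _) (sum_nonneg fun X _ => mul_nonneg ?_ (norm_nonneg _))
  exact zero_le_one.trans (one_le_klScaleWt L M β n _)

/-! ## §3 (E1-W) — the weighted pinned profile of the analysed scale-`n` action within an abstract degree budget -/

/-- **`KernelNormsWt N … K n`** — the scale-`n` WEIGHTED KERNEL PROFILE of the frame `K`: in every degree `m`, for every pinned leg `q` and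
field index `w`, `klWtPinnedSum … n m q w ≤ N m`.  `N : ℕ → ℝ` is the degree budget (a closed term of the E1/E4 lanes when threaded through the
skeleton like (E1-F); the (E1-v4)-type shape is `N (2p) ≍ CE^p ε_n^{p−1} 2^{(3p−5)n}` up to the label sums, the (E4)-type shape in degree `4`
with all labels free is `N 4 ≤ klE0·E·Klam·|U|`). -/
def KernelNormsWt (N : ℕ → ℝ) (β U μ : ℝ) (K : TrigPolyC4v) (n : ℕ) : Prop :=
  ∀ (m : ℕ) (q : Fin m) (w : SpaceTimeIdx L M × SectorLeg (sectorCount n)), klWtPinnedSum L M β U μ K n m q w ≤ N m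

variable {L M}

/-- A larger budget is still met. -/
theorem KernelNormsWt.mono {N N' : ℕ → ℝ} {β U μ : ℝ} {K : TrigPolyC4v} {n : ℕ} (h : KernelNormsWt L M N β U μ K n)
    (hNN' : ∀ m, N m ≤ N' m) : KernelNormsWt L M N' β U μ K n :=
  fun m q w => (h m q w).trans (hNN' m)

/-- The degree-`4` clause of `KernelNormsWt`, leg `0` pinned at the origin with label `ℓ₀` (what (E4)ₙ reads). -/
theorem KernelNormsWt.four [NeZero M] {N : ℕ → ℝ} {β U μ : ℝ} {K : TrigPolyC4v} {n : ℕ} (h : KernelNormsWt L M N β U μ K n)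
    (ℓ₀ : SectorLeg (sectorCount n)) : klWtPinnedSum L M β U μ K n 4 0 ((0 : SpaceTimeIdx L M), ℓ₀) ≤ N 4 :=
  h 4 0 _

/-! ## §4 The door: first space-time moments from the degree-`4` weighted pinned sum -/

/-- **First moments are dominated by the weighted pinned sum** (pure bookkeeping, every scale `n`, `β ≥ 0`): for every label 4-tuple `Ω` and
legs `i, k`,
`Λ_n · ε_x³ · Σ_x spaceTimeDist(x_i, x_k) · ‖klAnisoLegKernel … klE0 n 4 Ω (0, x)‖ ≤ klWtPinnedSum … n 4 0 (0, Ω 0)`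
(`x ↦ ((0,Ω 0), (x₁,Ω 1), (x₂,Ω 2), (x₃,Ω 3))` injects the free positions into the tuples pinned at `(0, Ω 0)`; `Λ_n·dist ≤ wt − 1 ≤ wt`). -/
theorem klScale_mul_firstMoment_le_klWtPinnedSum [NeZero M] {β : ℝ} (hβ : 0 ≤ β) (U μ : ℝ) (K : TrigPolyC4v) (n : ℕ)
    (Ω : Fin 4 → SectorLeg (sectorCount n)) (i k : Fin 4) :
    klScale klE0 n * (imagTimeWeight β M ^ 3 *
        ∑ x : Fin 3 → SpaceTimeIdx L M,
          KLRegimeSplit.spaceTimeDist L M β (Matrix.vecCons (0 : SpaceTimeIdx L M) x i) (Matrix.vecCons (0 : SpaceTimeIdx L M) x k) *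
            ‖klAnisoLegKernel L M β U μ K klE0 n 4 Ω (Matrix.vecCons (0 : SpaceTimeIdx L M) x)‖) ≤
      klWtPinnedSum L M β U μ K n 4 0 ((0 : SpaceTimeIdx L M), Ω 0) := by
  set E := sectorAnalysisMatrix L M β (klAnisoFamily L M β μ K klE0 n) with hE
  set W := klEffectiveAction L M β U μ K klE0 n with hW
  set wt := klScaleWt L M β n with hwt
  -- the injection of the free positions into the pinned tuples
  set Φ : (Fin 3 → SpaceTimeIdx L M) → (Fin 4 → SpaceTimeIdx L M × SectorLeg (sectorCount n)) :=
    fun x j => (Matrix.vecCons (0 : SpaceTimeIdx L M) x j, Ω j) with hΦ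
  have hΦinj : Function.Injective Φ := by
    intro x x' h
    funext j
    have hj := congrFun h j.succ
    rw [hΦ] at hj
    simpa using (Prod.ext_iff.1 hj).1
  have hΦmem : ∀ x, Φ x ∈ univ.filter (fun X : Fin 4 → SpaceTimeIdx L M × SectorLeg (sectorCount n) =>
      X 0 = ((0 : SpaceTimeIdx L M), Ω 0)) := fun x => by
    refine mem_filter.2 ⟨mem_univ _, ?_⟩
    rw [hΦ]
    rfl
  -- termwise: `Λ_n · dist · ‖W̄‖ ≤ wt · ‖kernel‖`
  have hterm : ∀ x : Fin 3 → SpaceTimeIdx L M,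
      klScale klE0 n * (KLRegimeSplit.spaceTimeDist L M β (Matrix.vecCons (0 : SpaceTimeIdx L M) x i)
          (Matrix.vecCons (0 : SpaceTimeIdx L M) x k) *
          ‖klAnisoLegKernel L M β U μ K klE0 n 4 Ω (Matrix.vecCons (0 : SpaceTimeIdx L M) x)‖) ≤
        wt ((univ.image (Φ x)).image (latticeLegPos (2 * (2 * M)))) *
          ‖kernel ℂ (ExteriorAlgebra.map (Matrix.toLin' E) W) 4 (Φ x)‖ := by
    intro x
    have hker : klAnisoLegKernel L M β U μ K klE0 n 4 Ω (Matrix.vecCons (0 : SpaceTimeIdx L M) x) =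
        kernel ℂ (ExteriorAlgebra.map (Matrix.toLin' E) W) 4 (Φ x) :=
      klAnisoLegKernel_eq_kernel_map β U μ K klE0 n 4 Ω _
    rw [hker, ← mul_assoc]
    refine mul_le_mul_of_nonneg_right ?_ (norm_nonneg _)
    have hd := klScale_mul_spaceTimeDist_le_klScaleWt_image_sub_one (L := L) (M := M) hβ n (Φ x) i k
    have h1 := one_le_klScaleWt L M β n ((univ.image (Φ x)).image (latticeLegPos (2 * (2 * M))))
    have hΦi : (Φ x i).1 = Matrix.vecCons (0 : SpaceTimeIdx L M) x i := rfl
    have hΦk : (Φ x k).1 = Matrix.vecCons (0 : SpaceTimeIdx L M) x k := rfl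
    rw [hΦi, hΦk] at hd
    rw [hwt]
    linarith
  have hε : 0 ≤ imagTimeWeight β M ^ 3 := pow_nonneg (imagTimeWeight_nonneg hβ M) 3
  have hwt0 : ∀ S, 0 ≤ wt S := fun S => zero_le_one.trans (one_le_klScaleWt L M β n S)
  rw [klWtPinnedSum_def, show (4 - 1 : ℕ) = 3 from rfl, mul_left_comm]
  refine mul_le_mul_of_nonneg_left ?_ hε
  rw [mul_sum]
  calc ∑ x : Fin 3 → SpaceTimeIdx L M, klScale klE0 n *
          (KLRegimeSplit.spaceTimeDist L M β (Matrix.vecCons (0 : SpaceTimeIdx L M) x i) (Matrix.vecCons (0 : SpaceTimeIdx L M) x k) *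
            ‖klAnisoLegKernel L M β U μ K klE0 n 4 Ω (Matrix.vecCons (0 : SpaceTimeIdx L M) x)‖)
      ≤ ∑ x : Fin 3 → SpaceTimeIdx L M, wt ((univ.image (Φ x)).image (latticeLegPos (2 * (2 * M)))) *
          ‖kernel ℂ (ExteriorAlgebra.map (Matrix.toLin' E) W) 4 (Φ x)‖ := sum_le_sum fun x _ => hterm x
    _ = ∑ X ∈ (univ : Finset (Fin 3 → SpaceTimeIdx L M)).image Φ, wt ((univ.image X).image (latticeLegPos (2 * (2 * M)))) *
          ‖kernel ℂ (ExteriorAlgebra.map (Matrix.toLin' E) W) 4 X‖ := by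
        rw [sum_image fun x _ x' _ h => hΦinj h]
    _ ≤ ∑ X ∈ univ.filter (fun X : Fin 4 → SpaceTimeIdx L M × SectorLeg (sectorCount n) => X 0 = ((0 : SpaceTimeIdx L M), Ω 0)),
          wt ((univ.image X).image (latticeLegPos (2 * (2 * M)))) * ‖kernel ℂ (ExteriorAlgebra.map (Matrix.toLin' E) W) 4 X‖ := by
        refine sum_le_sum_of_subset_of_nonneg (fun X hX => ?_) fun X _ _ => mul_nonneg (hwt0 _) (norm_nonneg _)
        obtain ⟨x, -, rfl⟩ := mem_image.1 hX
        exact hΦmem x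

/-- **THE (E4)ₙ DOOR.**  If at scale `n` the degree-`4` weighted pinned sum of the analysed action, leg `0` pinned at the origin, obeys
`klWtPinnedSum … n 4 0 (0, ℓ₀) ≤ klE0 · (G.cE4 + Q.cE4·|U|) · P.Klam · |U|` for every first label `ℓ₀` (an `n`-FREE budget, since distances are
measured in units of `Λ_n⁻¹`), then `EngineFirstMoments L M G P Q β U μ K n` (`β > 0`). -/
theorem engineFirstMoments_of_wtPinnedSum [NeZero M] {β : ℝ} (hβ : 0 < β) {U μ : ℝ} {K : TrigPolyC4v} {n : ℕ}
    {G : GeoConsts} {P : SplitConsts} {Q : EngConsts}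
    (h : ∀ ℓ₀ : SectorLeg (sectorCount n),
      klWtPinnedSum L M β U μ K n 4 0 ((0 : SpaceTimeIdx L M), ℓ₀) ≤ klE0 * ((G.cE4 + Q.cE4 * |U|) * P.Klam * |U|)) :
    EngineFirstMoments L M G P Q β U μ K n := by
  intro Ω i k
  have hΛ := klth_klScale_pos n
  have hmain := (klScale_mul_firstMoment_le_klWtPinnedSum (L := L) (M := M) hβ.le U μ K n Ω i k).trans (h (Ω 0))
  -- divide by `Λ_n` and use `Λ_n · 4ⁿ = klE0`
  have e := klScale_klE0_mul_four_pow n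
  set B : ℝ := (G.cE4 + Q.cE4 * |U|) * P.Klam * |U| with hB
  have h2 : klE0 * B / klScale klE0 n = B * (4 : ℝ) ^ n := by
    rw [show klE0 * B / klScale klE0 n = klScale klE0 n * (4 : ℝ) ^ n * B / klScale klE0 n by rw [e]]
    field_simp
  calc _ = klScale klE0 n * (imagTimeWeight β M ^ 3 *
          ∑ x : Fin 3 → SpaceTimeIdx L M,
            KLRegimeSplit.spaceTimeDist L M β (Matrix.vecCons (0 : SpaceTimeIdx L M) x i) (Matrix.vecCons (0 : SpaceTimeIdx L M) x k) *
              ‖klAnisoLegKernel L M β U μ K klE0 n 4 Ω (Matrix.vecCons (0 : SpaceTimeIdx L M) x)‖) / klScale klE0 n :=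
        (mul_div_cancel_left₀ _ hΛ.ne').symm
    _ ≤ klE0 * B / klScale klE0 n := div_le_div_of_nonneg_right hmain hΛ.le
    _ = B * (4 : ℝ) ^ n := h2

/-- **(E4)ₙ from the weighted profile (E1-W)**: `KernelNormsWt N … n` with `N 4 ≤ klE0·(G.cE4 + Q.cE4|U|)·Klam·|U|` gives
`EngineFirstMoments … n`. -/
theorem engineFirstMoments_of_kernelNormsWt [NeZero M] {β : ℝ} (hβ : 0 < β) {U μ : ℝ} {K : TrigPolyC4v} {n : ℕ} {N : ℕ → ℝ}
    {G : GeoConsts} {P : SplitConsts} {Q : EngConsts} (h : KernelNormsWt L M N β U μ K n)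
    (hN : N 4 ≤ klE0 * ((G.cE4 + Q.cE4 * |U|) * P.Klam * |U|)) : EngineFirstMoments L M G P Q β U μ K n :=
  engineFirstMoments_of_wtPinnedSum hβ fun ℓ₀ => (h.four ℓ₀).trans hN

end Model

/-! ## §5 The admissible (E4)ₙ constant at the gen-6 engine package (literal binders of stub (c), skeleton v3-α) -/

/-- **`E4ScaleAt E`** — `E` is an admissible constant for the first-moment clause at the INDUCTIVE scales: under exactly the binders of
stub (c) `stub_engine_step_values` of 20236's skeleton v3-α (package `klEngGeo5 / klEngQ5 P R / klEngC₃3 / klEngU₀4 / klEngL₃ / klEngM₃`,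
`1 ≤ n ≤ nScales β + 1`, `IsKLRegime`, the history `HistP klPredsV16 … n`, (E1-v4) at `n`, (E1-F) at every `j ≤ n`), every first space-time moment
of the scale-`n` sectorised quartic kernel is `≤ E · P.Klam · |U| · 4ⁿ`. -/
def E4ScaleAt (E : ℝ) : Prop :=
  ∀ (P : SplitConsts) (R : RenConsts) (c : ℝ), P.WF → R.WF2 → 0 < c → c ≤ klEngC₃3 P R → ∀ μ ∈ klWindowC, ∀ U : ℝ, 0 < U →
    U ≤ klEngU₀4 P R c → ∀ β : ℝ, klBetaMin ≤ β → β ≤ Real.exp (c / U ^ 2) → ∀ K : TrigPolyC4v, FrameOK R U (nScales β) μ K →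
    ∀ (L M : ℕ) [NeZero L] [NeZero M], klEngL₃ β U ≤ L → klEngM₃ β U L ≤ M → ∀ n : ℕ, 1 ≤ n → n ≤ nScales β + 1 →
    IsKLRegime U c (-(n : ℤ)) → HistP klPredsV16 L M klEngGeo5 P (klEngQ5 P R) R β U μ K n →
    KernelNormsV4 L M P (klEngQ5 P R) β U μ K n → (∀ j ≤ n, KernelNormsLevels L M P (klEngQ5 P R) β U μ K j) →
    ∀ (Ω : Fin 4 → SectorLeg (sectorCount n)) (i k : Fin 4),
      imagTimeWeight β M ^ 3 *
          ∑ x : Fin 3 → SpaceTimeIdx L M,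
            KLRegimeSplit.spaceTimeDist L M β (Matrix.vecCons (0 : SpaceTimeIdx L M) x i) (Matrix.vecCons (0 : SpaceTimeIdx L M) x k) *
              ‖klAnisoLegKernel L M β U μ K klE0 n 4 Ω (Matrix.vecCons (0 : SpaceTimeIdx L M) x)‖ ≤
        E * P.Klam * |U| * (4 : ℝ) ^ n

/-- A larger constant is still admissible (`0 ≤ P.Klam` from `P.WF`). -/
theorem E4ScaleAt.mono {E E' : ℝ} (h : E4ScaleAt E) (hEE' : E ≤ E') : E4ScaleAt E' := by
  intro P R c hP hR hc hc₃ μ hμ U hU hU₀ β hβ hβc K hK L M _ _ hL hM n hn hnle hreg hhist hE1 hlev Ω i k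
  refine (h P R c hP hR hc hc₃ μ hμ U hU hU₀ β hβ hβc K hK L M hL hM n hn hnle hreg hhist hE1 hlev Ω i k).trans ?_
  have hK0 : 0 ≤ P.Klam := zero_le_one.trans hP.1
  have : 0 ≤ P.Klam * |U| * (4 : ℝ) ^ n := by positivity
  nlinarith

open Classical in
/-- **`klE4Tn`** — THE (E4) constant of the inductive scales: a nonnegative admissible constant when one exists, `0` otherwise (a closed term, twin
of `klE4T`; a later package may carry `cE4 := max (max 2^10 klE4T) klE4Tn`). -/
def klE4Tn : ℝ := if h : (∃ E : ℝ, 0 ≤ E ∧ E4ScaleAt E) then Classical.choose h else 0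

/-- `0 ≤ klE4Tn`. -/
theorem klE4Tn_nonneg : 0 ≤ klE4Tn := by
  classical
  unfold klE4Tn
  split_ifs with h
  · exact (Classical.choose_spec h).1
  · exact le_rfl

/-- **`klE4Tn` is admissible as soon as any nonnegative constant is.** -/
theorem e4ScaleAt_klE4Tn {E : ℝ} (hE0 : 0 ≤ E) (hE : E4ScaleAt E) : E4ScaleAt klE4Tn := by
  classical
  have h : ∃ E : ℝ, 0 ≤ E ∧ E4ScaleAt E := ⟨E, hE0, hE⟩
  have : klE4Tn = Classical.choose h := by unfold klE4Tn; exact dif_pos h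
  rw [this]
  exact (Classical.choose_spec h).2

/-- **Consumer form** (the value lane's `hE4` residue): from any witness `E4ScaleAt E` and a well-formed `G` with `E ≤ G.cE4`, under the binders
of stub (c), `EngineFirstMoments L M G P (klEngQ5 P R) β U μ K n` — in particular at `G = klEngGeo5` when `E ≤ klEngGeo5.cE4`
(`= max 2^10 klE4T`, `klEngGeo5_cE4`/`klEngGeo4_cE4`). -/
theorem engineFirstMoments_of_e4ScaleAt {E : ℝ} (hE : E4ScaleAt E) (G : GeoConsts) (hcE4 : E ≤ G.cE4)
    (P : SplitConsts) (R : RenConsts) (c : ℝ) (hP : P.WF) (hR : R.WF2) (hc : 0 < c) (hc₃ : c ≤ klEngC₃3 P R)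
    (μ : ℝ) (hμ : μ ∈ klWindowC) (U : ℝ) (hU : 0 < U) (hU₀ : U ≤ klEngU₀4 P R c) (β : ℝ) (hβ : klBetaMin ≤ β)
    (hβc : β ≤ Real.exp (c / U ^ 2)) (K : TrigPolyC4v) (hK : FrameOK R U (nScales β) μ K) (L M : ℕ) [NeZero L] [NeZero M]
    (hL : klEngL₃ β U ≤ L) (hM : klEngM₃ β U L ≤ M) (n : ℕ) (hn : 1 ≤ n) (hnle : n ≤ nScales β + 1) (hreg : IsKLRegime U c (-(n : ℤ)))
    (hhist : HistP klPredsV16 L M klEngGeo5 P (klEngQ5 P R) R β U μ K n) (hE1 : KernelNormsV4 L M P (klEngQ5 P R) β U μ K n)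
    (hlev : ∀ j ≤ n, KernelNormsLevels L M P (klEngQ5 P R) β U μ K j) :
    EngineFirstMoments L M G P (klEngQ5 P R) β U μ K n := by
  intro Ω i k
  refine (hE P R c hP hR hc hc₃ μ hμ U hU hU₀ β hβ hβc K hK L M hL hM n hn hnle hreg hhist hE1 hlev Ω i k).trans ?_
  have hK0 : 0 ≤ P.Klam := zero_le_one.trans hP.1
  have hQ0 : 0 ≤ (klEngQ5 P R).cE4 := (klEngQ5_wf P R).2.2.2.1
  have h1 : 0 ≤ P.Klam * |U| * (4 : ℝ) ^ n := by positivity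
  have h2 : E ≤ G.cE4 + (klEngQ5 P R).cE4 * |U| := hcE4.trans (le_add_of_nonneg_right (mul_nonneg hQ0 (abs_nonneg U)))
  calc E * P.Klam * |U| * (4 : ℝ) ^ n = E * (P.Klam * |U| * (4 : ℝ) ^ n) := by ring
    _ ≤ (G.cE4 + (klEngQ5 P R).cE4 * |U|) * (P.Klam * |U| * (4 : ℝ) ^ n) := mul_le_mul_of_nonneg_right h2 h1
    _ = _ := by ring

/-- **Producer form**: a scale-uniform bound of the degree-`4` weighted pinned sums UNDER THE BINDERS OF STUB (c),
`klWtPinnedSum … n 4 0 (0, ℓ₀) ≤ klE0 · E · P.Klam · |U|`, makes `E` an admissible (E4)ₙ constant. -/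
theorem e4ScaleAt_of_wtPinnedSum {E : ℝ}
    (h : ∀ (P : SplitConsts) (R : RenConsts) (c : ℝ), P.WF → R.WF2 → 0 < c → c ≤ klEngC₃3 P R → ∀ μ ∈ klWindowC, ∀ U : ℝ, 0 < U →
      U ≤ klEngU₀4 P R c → ∀ β : ℝ, klBetaMin ≤ β → β ≤ Real.exp (c / U ^ 2) → ∀ K : TrigPolyC4v, FrameOK R U (nScales β) μ K →
      ∀ (L M : ℕ) [NeZero L] [NeZero M], klEngL₃ β U ≤ L → klEngM₃ β U L ≤ M → ∀ n : ℕ, 1 ≤ n → n ≤ nScales β + 1 →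
      IsKLRegime U c (-(n : ℤ)) → HistP klPredsV16 L M klEngGeo5 P (klEngQ5 P R) R β U μ K n →
      KernelNormsV4 L M P (klEngQ5 P R) β U μ K n → (∀ j ≤ n, KernelNormsLevels L M P (klEngQ5 P R) β U μ K j) →
      ∀ ℓ₀ : SectorLeg (sectorCount n), klWtPinnedSum L M β U μ K n 4 0 ((0 : SpaceTimeIdx L M), ℓ₀) ≤ klE0 * (E * P.Klam * |U|)) :
    E4ScaleAt E := by
  intro P R c hP hR hc hc₃ μ hμ U hU hU₀ β hβ hβc K hK L M _ _ hL hM n hn hnle hreg hhist hE1 hlev Ω i k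
  have hβ0 : 0 < β := lt_of_lt_of_le (by norm_num [klBetaMin]) hβ
  have hΛ := klth_klScale_pos n
  have hmain := (klScale_mul_firstMoment_le_klWtPinnedSum (L := L) (M := M) hβ0.le U μ K n Ω i k).trans
    (h P R c hP hR hc hc₃ μ hμ U hU hU₀ β hβ hβc K hK L M hL hM n hn hnle hreg hhist hE1 hlev (Ω 0))
  have e := klScale_klE0_mul_four_pow n
  set B : ℝ := E * P.Klam * |U| with hB
  have h2 : klE0 * B / klScale klE0 n = B * (4 : ℝ) ^ n := by
    rw [show klE0 * B / klScale klE0 n = klScale klE0 n * (4 : ℝ) ^ n * B / klScale klE0 n by rw [e]]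
    field_simp
  calc _ = klScale klE0 n * (imagTimeWeight β M ^ 3 *
          ∑ x : Fin 3 → SpaceTimeIdx L M,
            KLRegimeSplit.spaceTimeDist L M β (Matrix.vecCons (0 : SpaceTimeIdx L M) x i) (Matrix.vecCons (0 : SpaceTimeIdx L M) x k) *
              ‖klAnisoLegKernel L M β U μ K klE0 n 4 Ω (Matrix.vecCons (0 : SpaceTimeIdx L M) x)‖) / klScale klE0 n :=
        (mul_div_cancel_left₀ _ hΛ.ne').symm
    _ ≤ klE0 * B / klScale klE0 n := div_le_div_of_nonneg_right hmain hΛ.le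
    _ = B * (4 : ℝ) ^ n := h2

end Summit.HubbardSuperconductivity.HubbardSuperconductivity.Theorems.EngineV8

end
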